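import Literature.AnabelianGeometry.EtaleTheta.LogDivisorModelTateTower
import Mathlib.Data.Finsupp.Basic
import HarnessLib

/-!
# [IUTchI] Ex. 3.2 / [EtTh] §1, Def. 3.1 — GAP A item GA-10 (file 1 of 2): the LEVEL MODEL of the theta envelope — the special fibre
# «components ⊔ cusps» of a finite étale piece of the [EtTh] §1 `ℤ(×μ₂)`-covering with the theta translates, as an inhabitant of the
# Def. 3.1 / Prop. 3.2 interface `LogDivisorModel`

S. Mochizuki, *The étale theta function and its Frobenioid-theoretic manifestations*, Publ. RIMS **45** (2009) [MochizukiEtTh2009],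
§1 Prop. 1.4 (i) p.247 (PDF p.21) («the zeroes of `Θ̈` on `Ÿ` are precisely the cusps of `Ÿ`; each zero has multiplicity 1. The divisor of
poles of `Θ̈` on `Ÿ` is precisely the divisor `D_1`»), Rmk. 1.3.1 p.247 («`D_1` … does not descend»), §3 Def. 3.1 / Prop. 3.2 p.296 (PDF p.70),
Rmk. 3.3.1 p.299 (PDF p.73) («… `Gal(Z^log_∞/Y^log)`-orbits of prime log-divisors»); S. Mochizuki, *Inter-universal Teichmüller theory I*,
Ex. 3.2 (i)(ii) pp.70–71 (`Ÿ_v → X̲̲_v`). [cite: MochizukiEtTh2009, Def 3.1 p.70] [cite: Mochizuki2012, I Ex 3.2 (i)(ii) pp.70-71]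

abc-iut cell, GAP A (foundations gap G-L5-EX32I-1 — the UNDISPUTED construction around [IUTchIII] Cor. 3.12), item **GA-10** = D2 geometric half of
`GAP-SIZING-A.md` (69de97346848d3e8) under abc-iut-L5-lead RULINGS #317 (2) / #319 / #321 (D0′) / #322 (c2′)(c3′), ruled shapes
`plan/L5/GAP-A-SIGNATURES.md` v1 (e3ccddf9b87597cf) §2, SIGNATURE + SIG-DELTA countersigned RULINGS #338 (B), keeper-A word 20:59:06Z.
CLASS (b) CONSTRUCTION (definitions + theorems; the frozen interface `LogDivisorModel` (`TemperedCoverings.lean`) is consumed BY NAME; pattern =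
abc-iut-L2-t3's `Ÿ`-skeleton `TateTowerTheta.model`, `LogDivisorModelTateTowerTheta.lean`).  THIS FILE:
* **`Envelope.model C : LogDivisorModel.{0}`** for a set `C` of special-fibre COMPONENTS (print: the components of the special fibre of `Y` form a
  TORSOR under `Gal(Y/X) = ℤ`; at a finite étale piece an `n`-cycle; here ANY index set — the cycle's adjacency is invisible to Def. 3.1's
  `DIV⁺ ≅ ℕ^{Cusp ⊔ Comp}`): `Comp := C`, `Cusp := C × Bool` (the two zeros `Ü = ±q^{j/2}` of `Θ̈` on each component, as the `Ÿ`-skeleton),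
  `DIV := ℤ^{Cusp ⊔ Comp}`, every log-divisor Cartier, **`Fn := Multiplicative (C →₀ ℤ)` = the free abelian group on the Θ̈-TRANSLATES
  `Θ̈_c (c ∈ C)`** — the «ϖ̈-free part» of the ruled `B₀^geom = ⟨Ü, ϖ̈-free part, Θ̈-translates, μ⟩`: NO uniformiser and NO constants
  (`const = intConst = ⊥`; constants enter in GA-02 through the genuine constant tower `T.proj ⋙ constTower d`, RULINGS #321 «constants bypass the
  rebase»), NO coordinate `Ü` (`ord_{F_j} Ü = j` has no finite-level avatar), sign-free (as the fourth tower model's levels, design (β) of record);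
  `divisor (∏_c Θ̈_c^{m_c}) := (cusp ↦ Σ_c m_c ; F_c ↦ −m_c)`, i.e. **`div Θ̈_c = [every cusp, multiplicity 1] − [F_c]`**: the zero divisor VERBATIM as
  print / `TateTowerTheta.thetaZeros`; the polar divisor is the DECREED finite avatar `[F_c]` of print's `D_1 = Σ_j j²·F_j` on the infinite chain, which
  descends to no finite level (Rmk. 1.3.1) — LABELLED DECREE; Prop. 3.2 (ii) («an effective principal divisor is an integral constant», here:
  trivial) and (iii) PROVED (`eq_zero_of_divFun_nonneg`), every field of the v3 interface proved, none vacuous, nothing needs `C` finite;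
* `Envelope.cuspLaws`; `Envelope.theta c`, `Envelope.thetaZeros`, `Envelope.thetaPoles c`, **`Envelope.divisor_theta : div Θ̈_c = thetaZeros / thetaPoles c`**.
File 2 (`ArithThetaTowerEnvelope.lean`): the DECK ACTION `Envelope.action`, the ruled decl `ArithThetaTower.divisorsGeom` over `CosetCat Γ`, the
theta section and its `div₀`.  HONEST FRAMING: a class-(b) combinatorial LEVEL MODEL — print's [EtTh] §1 recipe for the special fibre of `Ÿ`
TRANSPORTED to a component set (for the kit's profinite `Π` every `Ÿ_T` is a FINITE-level avatar, FOUNDATIONS 13 U2; print's `Θ̈` lives on the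
INFINITE chain `Ÿ`; [EtTh] Def. 3.3 at general coverings and print's `Ÿ̈/μ_N` Kummer levels = FOUNDATIONS 13/14, NOT claimed); NOT the formal
scheme, NOT the tempered Frobenioid of a Tate curve; no Prop-valued fact, no instance, no notation, no sorry; nothing here bears on [IUTchIII]
Cor. 3.12; NO side taken (D-0045); typed ≠ inhabited ≠ proved-in-print; count-neutral; NO abc claim.
-/

noncomputable section

namespace Literature.AnabelianGeometry.EtaleTheta

namespace ArithThetaTower

namespace Envelope

open LogDivisorModel

variable (C : Type)

/-! ## §1 Prime log-divisors of the level: components `C`, cusps `C × Bool` -/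

/-- The cusps of the level: on the component `F_c` the two zeros `Ü = ±q^{j/2}` of `Θ̈` (as `TateTowerTheta.Cusp = ℤ × Bool`).
[cite: MochizukiEtTh2009, Prop 1.4 p.21] -/
abbrev Cusp : Type := C × Bool

/-- Index of prime log-divisors of the level: cusps `C × Bool`, components `C`. [cite: MochizukiEtTh2009, Def 3.1 p.70] -/
abbrev Idx : Type := Cusp C ⊕ C

/-- **The total Θ̈-degree `Σ_c m_c`** of a product of theta translates `∏_c Θ̈_c^{m_c}` (its order at every cusp).
[cite: MochizukiEtTh2009, Prop 1.4 p.21] -/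
def deg : (C →₀ ℤ) →+ ℤ where
  toFun m := m.sum fun _ k => k
  map_zero' := Finsupp.sum_zero_index
  map_add' _ _ := Finsupp.sum_add_index' (fun _ => rfl) (fun _ _ _ => rfl)

/-- `deg` is the sum of the exponents over the support. [cite: MochizukiEtTh2009, Prop 1.4 p.21] -/
theorem deg_apply (m : C →₀ ℤ) : deg C m = ∑ c ∈ m.support, m c := rfl

/-- `deg Θ̈_c^k = k`. [cite: MochizukiEtTh2009, Prop 1.4 p.21] -/
@[simp] theorem deg_single (c : C) (k : ℤ) : deg C (Finsupp.single c k) = k := by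
  change (Finsupp.single c k).sum (fun _ k => k) = k
  exact Finsupp.sum_single_index rfl

/-- The total degree is invariant under relabelling the translates. [cite: MochizukiEtTh2009, Prop 1.4 p.22] -/
theorem deg_equivMapDomain (σ : C ≃ C) (m : C →₀ ℤ) : deg C (Finsupp.equivMapDomain σ m) = deg C m := by
  change (Finsupp.equivMapDomain σ m).sum (fun _ k => k) = m.sum (fun _ k => k)
  exact Finsupp.sum_equivMapDomain σ m _

/-- **The divisor of `∏_c Θ̈_c^{m_c}`**: order `Σ_c m_c` at every cusp (simple zeros of every translate at every cusp, Prop. 1.4 (i)),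
order `−m_c` along `F_c` (the DECREED finite avatar `[F_c]` of the polar divisor `D_1` of the `c`-th translate).
[cite: MochizukiEtTh2009, Prop 1.4 p.21] -/
def divFun (m : C →₀ ℤ) : Idx C → ℤ
  | Sum.inl _ => deg C m
  | Sum.inr c => -(m c)

/-- `divFun` at a cusp. [cite: MochizukiEtTh2009, Prop 1.4 p.21] -/
@[simp] theorem divFun_inl (m : C →₀ ℤ) (q : Cusp C) : divFun C m (Sum.inl q) = deg C m := rfl

/-- `divFun` along a component. [cite: MochizukiEtTh2009, Prop 1.4 p.21] -/
@[simp] theorem divFun_inr (m : C →₀ ℤ) (c : C) : divFun C m (Sum.inr c) = -(m c) := rfl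

/-- `divFun` is additive. [cite: MochizukiEtTh2009, Def 3.1 p.70] -/
theorem divFun_add (m m' : C →₀ ℤ) : divFun C (m + m') = divFun C m + divFun C m' := by
  funext x
  rcases x with q | c
  · simp only [divFun_inl, map_add, Pi.add_apply]
  · simp only [divFun_inr, Finsupp.add_apply, Pi.add_apply, neg_add]

/-- The divisor map `Fn = ℤ^{(C)} → DIV = ℤ^{Cusp ⊔ Comp}` as a homomorphism of multiplicative groups. [cite: MochizukiEtTh2009, Def 3.1 p.70] -/
def divHom : Multiplicative (C →₀ ℤ) →* Multiplicative (Idx C → ℤ) :=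
  AddMonoidHom.toMultiplicative
    { toFun := divFun C
      map_zero' := by funext x; rcases x with q | c <;> simp [divFun]
      map_add' := divFun_add C }

/-- `divHom` on elements. [cite: MochizukiEtTh2009, Def 3.1 p.70] -/
@[simp] theorem toAdd_divHom (f : Multiplicative (C →₀ ℤ)) (x : Idx C) :
    Multiplicative.toAdd (divHom C f) x = divFun C (Multiplicative.toAdd f) x := rfl

/-- **Prop. 3.2 (ii) for the level** («all regular functions are constant»; here the constants are trivial): a product of theta translates
with EFFECTIVE divisor is trivial — non-positivity along every component and non-negativity of the total degree at a cusp force `m = 0`.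
[cite: MochizukiEtTh2009, Prop 3.2 p.70] -/
theorem eq_zero_of_divFun_nonneg {m : C →₀ ℤ} (h : ∀ x, 0 ≤ divFun C m x) : m = 0 := by
  have hle : ∀ c, m c ≤ 0 := fun c => by
    have hc := h (Sum.inr c)
    rw [divFun_inr] at hc
    exact neg_nonneg.mp hc
  rcases isEmpty_or_nonempty C with hC | ⟨⟨c₀⟩⟩
  · exact Finsupp.ext fun c => isEmptyElim c
  · have hdeg : 0 ≤ ∑ c ∈ m.support, m c := by
      have h0 := h (Sum.inl (c₀, false))
      rwa [divFun_inl, deg_apply] at h0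
    have h0 : ∑ c ∈ m.support, m c = 0 := le_antisymm (Finset.sum_nonpos fun c _ => hle c) hdeg
    have hall := (Finset.sum_eq_zero_iff_of_nonpos fun c _ => hle c).1 h0
    refine Finsupp.ext fun c => ?_
    by_cases hc : c ∈ m.support
    · exact hall c hc
    · exact Finsupp.notMem_support_iff.1 hc

/-- Conversely the divisor is effective iff `m = 0`. [cite: MochizukiEtTh2009, Prop 3.2 p.70] -/
theorem divFun_nonneg_iff (m : C →₀ ℤ) : (∀ x, 0 ≤ divFun C m x) ↔ m = 0 :=
  ⟨eq_zero_of_divFun_nonneg C, fun h x => by rw [h]; rcases x with q | c <;> simp [divFun]⟩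

/-! ## §2 The interface inhabitant `Envelope.model C` -/

/-- Effective log-divisors of the level: non-negative multiplicity at every prime log-divisor. [cite: MochizukiEtTh2009, Def 3.1 p.70] -/
def effective : Submonoid (Multiplicative (Idx C → ℤ)) where
  carrier := {d | ∀ x, 0 ≤ Multiplicative.toAdd d x}
  mul_mem' := fun {a b} ha hb x => by rw [toAdd_mul, Pi.add_apply]; exact add_nonneg (ha x) (hb x)
  one_mem' := fun x => by rw [toAdd_one, Pi.zero_apply]

/-- Membership in `effective`, for a divisor given additively. [cite: MochizukiEtTh2009, Def 3.1 p.70] -/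
theorem ofAdd_mem_effective_iff (g : Idx C → ℤ) : Multiplicative.ofAdd g ∈ effective C ↔ ∀ x, 0 ≤ g x := Iff.rfl

/-- Non-cuspidal log-divisors: no multiplicity at the cusps. [cite: MochizukiEtTh2009, Def 3.1 p.70] -/
def nonCusp : Subgroup (Multiplicative (Idx C → ℤ)) where
  carrier := {d | ∀ q : Cusp C, Multiplicative.toAdd d (Sum.inl q) = 0}
  mul_mem' := fun {a b} ha hb q => by rw [toAdd_mul, Pi.add_apply, ha q, hb q, add_zero]
  one_mem' := fun q => by rw [toAdd_one, Pi.zero_apply]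
  inv_mem' := fun {a} ha q => by rw [toAdd_inv, Pi.neg_apply, ha q, neg_zero]

/-- Cuspidal log-divisors: no multiplicity along the special fibre. [cite: MochizukiEtTh2009, Def 3.1 p.70] -/
def cusp : Subgroup (Multiplicative (Idx C → ℤ)) where
  carrier := {d | ∀ c : C, Multiplicative.toAdd d (Sum.inr c) = 0}
  mul_mem' := fun {a b} ha hb c => by rw [toAdd_mul, Pi.add_apply, ha c, hb c, add_zero]
  one_mem' := fun c => by rw [toAdd_one, Pi.zero_apply]
  inv_mem' := fun {a} ha c => by rw [toAdd_inv, Pi.neg_apply, ha c, neg_zero]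

/-- **A log-divisor is uniquely the sum of a non-cuspidal and a cuspidal one.** [cite: MochizukiEtTh2009, Def 3.1 p.70] -/
theorem isCompl_nonCusp_cusp : IsCompl (nonCusp C) (cusp C) := by
  refine ⟨Subgroup.disjoint_def.mpr fun {d} hn hc => ?_, codisjoint_iff.mpr (eq_top_iff.mpr fun d _ => ?_)⟩
  · refine Multiplicative.toAdd.injective (funext fun x => ?_)
    rcases x with q | c
    · rw [hn q, toAdd_one, Pi.zero_apply]
    · rw [hc c, toAdd_one, Pi.zero_apply]
  · let a : Multiplicative (Idx C → ℤ) :=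
      Multiplicative.ofAdd fun x => Sum.elim (fun _ => 0) (fun c => Multiplicative.toAdd d (Sum.inr c)) x
    let b : Multiplicative (Idx C → ℤ) :=
      Multiplicative.ofAdd fun x => Sum.elim (fun q => Multiplicative.toAdd d (Sum.inl q)) (fun _ => 0) x
    have hab : d = a * b := Multiplicative.toAdd.injective (funext fun x => by rcases x with q | c <;> simp [a, b])
    rw [hab]
    exact Subgroup.mul_mem_sup (fun q => by simp [a]) (fun c => by simp [b])

/-- **The level model of the theta envelope as an inhabitant of the Def. 3.1 / Prop. 3.2 interface** (every field proved): `Fn = ℤ^{(C)}` (theta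
translates), `DIV = ℤ^{(C × Bool) ⊔ C}`, `DIV⁺` = effective, `Div = DIV`, `Mero = Fn`, `const = O^▷ = 1`, `Cusp = C × Bool`, `Comp = C`.
[cite: MochizukiEtTh2009, Def 3.1 p.70] -/
def model : LogDivisorModel.{0} where
  Fn := Multiplicative (C →₀ ℤ)
  DIV := Multiplicative (Idx C → ℤ)
  DIVplus := effective C
  Div := ⊤
  exists_div_eq d := by
    refine ⟨Multiplicative.ofAdd fun x => max (Multiplicative.toAdd d x) 0,
      (ofAdd_mem_effective_iff C _).2 fun x => le_max_right _ _,
      Multiplicative.ofAdd fun x => max (-Multiplicative.toAdd d x) 0,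
      (ofAdd_mem_effective_iff C _).2 fun x => le_max_right _ _, ?_⟩
    refine Multiplicative.toAdd.injective (funext fun x => ?_)
    rw [toAdd_mul, toAdd_ofAdd, toAdd_ofAdd, Pi.add_apply]
    rcases le_total 0 (Multiplicative.toAdd d x) with h | h
    · rw [max_eq_left h, max_eq_right (neg_nonpos.mpr h), add_zero]
    · rw [max_eq_right h, max_eq_left (neg_nonneg.mpr h), add_neg_cancel]
  eq_one_of_mem_of_inv_mem d hd hd' := by
    refine Multiplicative.toAdd.injective (funext fun x => le_antisymm ?_ (hd x))
    have h : 0 ≤ Multiplicative.toAdd d⁻¹ x := hd' x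
    rw [toAdd_inv, Pi.neg_apply] at h
    rw [toAdd_one, Pi.zero_apply]
    exact neg_nonneg.mp h
  nonCuspidal := nonCusp C
  cuspidal := cusp C
  nonCuspidal_isCompl_cuspidal := isCompl_nonCusp_cusp C
  logMero := ⊤
  divisor := (divHom C).comp (Subgroup.subtype ⊤)
  divisor_mem_Div _ := trivial
  const := ⊥
  const_le_logMero := bot_le
  intConst := ⊥
  intConst_le_const := le_rfl
  temperedMero := ⊤
  temperedMero_le_logMero := le_rfl
  exists_pow_mem_Div := ⟨1, fun _ => trivial⟩
  Cusp := Cusp C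
  Comp := C
  divPlusEquiv :=
    { toFun := fun d x => Multiplicative.ofAdd (Multiplicative.toAdd d.1 x).toNat
      invFun := fun m => ⟨Multiplicative.ofAdd fun x => ((Multiplicative.toAdd (m x) : ℕ) : ℤ),
        (ofAdd_mem_effective_iff C _).2 fun x => Int.natCast_nonneg _⟩
      left_inv := fun d => Subtype.ext (Multiplicative.toAdd.injective (funext fun x => by
        simp only [toAdd_ofAdd]
        exact Int.toNat_of_nonneg (d.2 x)))
      right_inv := fun m => funext fun x => by simp
      map_mul' := fun a b => funext fun x => by
        rw [Pi.mul_apply, ← ofAdd_add]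
        congr 1
        rw [Submonoid.coe_mul, toAdd_mul, Pi.add_apply]
        exact Int.toNat_add (a.2 x) (b.2 x) }
  divPlusEquiv_nonCuspidal d := by
    change (∀ q : Cusp C, Multiplicative.toAdd d.1 (Sum.inl q) = 0) ↔
      ∀ q : Cusp C, Multiplicative.ofAdd (Multiplicative.toAdd d.1 (Sum.inl q)).toNat = 1
    refine forall_congr' fun q => ?_
    rw [← ofAdd_zero, Multiplicative.ofAdd.injective.eq_iff, Int.toNat_eq_zero]
    exact ⟨fun h => h.le, fun h => le_antisymm h (d.2 _)⟩
  mem_intConst_of_divisor_mem f hf := by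
    have h : Multiplicative.toAdd f.1 = 0 := eq_zero_of_divFun_nonneg C hf
    change (f : Multiplicative (C →₀ ℤ)) ∈ (⊥ : Submonoid (Multiplicative (C →₀ ℤ)))
    rw [Submonoid.mem_bot]
    exact Multiplicative.toAdd.injective h
  divisor_mem_of_mem_intConst f hf := by
    have h : (f : Multiplicative (C →₀ ℤ)) = 1 := (Submonoid.mem_bot).1 hf
    have h' : Multiplicative.toAdd f.1 = 0 := by rw [h, toAdd_one]
    refine ⟨fun x => ?_, fun q => ?_⟩
    · change 0 ≤ divFun C (Multiplicative.toAdd f.1) x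
      rw [h']
      rcases x with q | c <;> simp [divFun]
    · change divFun C (Multiplicative.toAdd f.1) (Sum.inl q) = 0
      rw [divFun_inl, h', map_zero]
  divisor_eq_one_iff f := by
    constructor
    · intro h
      have h' : ∀ x, divFun C (Multiplicative.toAdd f.1) x = 0 := fun x => by
        have e := congrArg (fun d : Multiplicative (Idx C → ℤ) => Multiplicative.toAdd d x) h
        rw [toAdd_one, Pi.zero_apply] at e
        exact e
      have hm : Multiplicative.toAdd f.1 = 0 := Finsupp.ext fun c => by
        have hc := h' (Sum.inr c)
        rw [divFun_inr, neg_eq_zero] at hc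
        exact hc
      have hf : (f : Multiplicative (C →₀ ℤ)) = 1 := Multiplicative.toAdd.injective hm
      exact ⟨(Submonoid.mem_bot).2 hf, (Submonoid.mem_bot).2 (by rw [hf, inv_one])⟩
    · rintro ⟨hf, -⟩
      have h : (f : Multiplicative (C →₀ ℤ)) = 1 := (Submonoid.mem_bot).1 hf
      refine Multiplicative.toAdd.injective (funext fun x => ?_)
      change divFun C (Multiplicative.toAdd f.1) x = 0
      rw [h, toAdd_one]
      rcases x with q | c <;> simp [divFun]
  eq_one_of_forall_exists_pow_eq f hf := by
    -- an infinitely divisible element of the free abelian group `ℤ^{(C)}` is trivial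
    refine Multiplicative.toAdd.injective (Finsupp.ext fun c => ?_)
    refine TateTower.int_eq_zero_of_divisible _ fun N => ?_
    obtain ⟨g, hg⟩ := hf N
    refine ⟨Multiplicative.toAdd g c, ?_⟩
    have e := congrArg (fun u : Multiplicative (C →₀ ℤ) => Multiplicative.toAdd u c) hg
    simp only [toAdd_pow, Finsupp.smul_apply] at e
    rw [← e, nsmul_eq_mul]

/-- The divisor of a function of the level, on multiplicities. [cite: MochizukiEtTh2009, Def 3.1 p.70] -/
theorem toAdd_divisor (f : (model C).logMero) (x : Idx C) :
    Multiplicative.toAdd ((model C).divisor f) x = divFun C (Multiplicative.toAdd f.1) x := rfl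

/-- Multiplicities in the level model are the non-negative values. [cite: MochizukiEtTh2009, Def 3.1 p.70] -/
theorem mult_eq (d : (model C).DIVplus) (x : Idx C) : (model C).mult d x = (Multiplicative.toAdd (d : (model C).DIV) x).toNat := rfl

/-- The tacit cusp laws hold (cuspidal = no multiplicity along the components; every log-divisor Cartier).
[cite: MochizukiEtTh2009, Def 3.1 p.70] -/
theorem cuspLaws : (model C).CuspLaws where
  cuspidal_le_Div := fun _ _ => trivial
  mem_cuspidal_iff d := by
    refine forall_congr' fun c => ?_
    rw [mult_eq, Int.toNat_eq_zero]
    exact ⟨fun h => h.le, fun h => le_antisymm h (d.2 _)⟩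

/-! ## §3 The theta translates and the two halves of their divisors -/

variable {C}

/-- **The `c`-th theta translate `Θ̈_c ∈ Fn`** (print: the `Gal(Y/X) = ℤ`-translates of `Θ̈` on `Ÿ`, Prop. 1.4 (ii)).
[cite: MochizukiEtTh2009, Prop 1.4 p.21] -/
def theta (c : C) : (model C).Fn := Multiplicative.ofAdd (Finsupp.single c 1)

variable (C) in
/-- The divisor of zeros of every theta translate, additively: `1` at each cusp, `0` along the components. [cite: MochizukiEtTh2009, Prop 1.4 p.21] -/
def zerosFun : Idx C → ℤ := fun x => Sum.elim (fun _ => 1) (fun _ => 0) x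

/-- The DECREED polar divisor of `Θ̈_c`, additively: `0` at the cusps, `1` along `F_c`, `0` along the other components (finite avatar of `D_1`).
[cite: MochizukiEtTh2009, Rmk 1.3.1 p.21] -/
def polesFun (c : C) : Idx C → ℤ := fun x => Sum.elim (fun _ => 0) (fun c' => Finsupp.single c (1 : ℤ) c') x

variable (C) in
/-- **The divisor of zeros of the theta translates**: every cusp with multiplicity `1` (Prop. 1.4 (i), VERBATIM as `TateTowerTheta.thetaZeros`).
[cite: MochizukiEtTh2009, Prop 1.4 p.21] -/
def thetaZeros : (model C).DIVplus :=
  ⟨Multiplicative.ofAdd (zerosFun C), (ofAdd_mem_effective_iff C _).2 fun x => by rcases x with q | c <;> simp [zerosFun]⟩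

/-- **The polar divisor `[F_c]` of `Θ̈_c`** (decreed finite avatar of `D_1`) as an effective log-divisor. [cite: MochizukiEtTh2009, Rmk 1.3.1 p.21] -/
def thetaPoles (c : C) : (model C).DIVplus :=
  ⟨Multiplicative.ofAdd (polesFun c), (ofAdd_mem_effective_iff C _).2 fun x => by
    rcases x with q | c'
    · simp [polesFun]
    · change (0 : ℤ) ≤ Finsupp.single c (1 : ℤ) c'
      classical
      rw [Finsupp.single_apply]
      split_ifs <;> simp⟩

/-- The zero divisor, additively. [cite: MochizukiEtTh2009, Prop 1.4 p.21] -/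
theorem toAdd_thetaZeros : Multiplicative.toAdd (thetaZeros C : (model C).DIV) = zerosFun C := rfl

/-- `[F_c]`, additively. [cite: MochizukiEtTh2009, Rmk 1.3.1 p.21] -/
theorem toAdd_thetaPoles (c : C) : Multiplicative.toAdd (thetaPoles c : (model C).DIV) = polesFun c := rfl

/-- The zero divisor is CUSPIDAL («the zeroes of `Θ̈` are precisely the cusps»). [cite: MochizukiEtTh2009, Prop 1.4 p.21] -/
theorem thetaZeros_mem_cuspidal : (thetaZeros C : (model C).DIV) ∈ (model C).cuspidal := fun _ => rfl

/-- `[F_c]` is NON-CUSPIDAL (supported on the special fibre) and Cartier. [cite: MochizukiEtTh2009, Prop 1.4 p.21] -/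
theorem thetaPoles_mem_nonCuspidal (c : C) :
    (thetaPoles c : (model C).DIV) ∈ (model C).nonCuspidal ∧ (thetaPoles c : (model C).DIV) ∈ (model C).Div :=
  ⟨fun _ => rfl, trivial⟩

/-- Every function of the level is log-meromorphic. [cite: MochizukiEtTh2009, Def 3.1 p.70] -/
theorem theta_mem_logMero (c : C) : theta c ∈ (model C).logMero := Subgroup.mem_top _

/-- **Prop. 1.4 (i) shape at the level: `divisor Θ̈_c = (zeros at every cusp) − [F_c]`.** [cite: MochizukiEtTh2009, Prop 1.4 p.21] -/
theorem divisor_theta (c : C) :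
    (model C).divisor ⟨theta c, theta_mem_logMero c⟩ = (thetaZeros C : (model C).DIV) / (thetaPoles c : (model C).DIV) :=
  Multiplicative.toAdd.injective (funext fun x => by
    change divFun C (Finsupp.single c 1) x = zerosFun C x - polesFun c x
    rcases x with q | c'
    · rw [divFun_inl, deg_single]; rfl
    · rw [divFun_inr]
      change -(Finsupp.single c (1 : ℤ) c') = 0 - Finsupp.single c (1 : ℤ) c'
      rw [zero_sub])

/-- The zero divisor is not trivial as soon as there is a component (the level HAS cusps). [cite: MochizukiEtTh2009, Prop 1.4 p.21] -/
theorem thetaZeros_ne_one [h : Nonempty C] : thetaZeros C ≠ 1 := fun e => by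
  obtain ⟨c⟩ := h
  have e' := congrArg (fun d : (model C).DIVplus => (model C).mult d (Sum.inl (c, false))) e
  simp only [mult_eq, (model C).mult_one] at e'
  exact one_ne_zero e'

/-- `[F_c]` is not trivial. [cite: MochizukiEtTh2009, Rmk 1.3.1 p.21] -/
theorem thetaPoles_ne_one (c : C) : thetaPoles c ≠ 1 := fun e => by
  have e' := congrArg (fun d : (model C).DIVplus => Multiplicative.toAdd (d : (model C).DIV) (Sum.inr c)) e
  change Finsupp.single c (1 : ℤ) c = (0 : ℤ) at e'
  rw [Finsupp.single_eq_same] at e'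
  exact one_ne_zero e'

end Envelope

end ArithThetaTower

end Literature.AnabelianGeometry.EtaleTheta

end
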